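import Summits.PneNP.PneNP.Theorems.SymmetryBudgetNoHiddenOrderBitValuationCover

/-!
# `NoHiddenOrder` (stmt-PneNP-14781), (R2c) value layer I: the bit valuation — the enumeration read off the pasted layout

Route `PneNP/SymmetryBudget`; continues `SymmetryBudgetNoHiddenOrderBitValuationCover.lean`.  The enumeration `pasteEnum`
of the block: row `i`, covered by the class of `J` in copy `q` at offset `o`, is the `o`-th vertex of the `q`-th part of that
class (`classPart`, through `Finset.equivFin` of the class).  It is well defined (`pasteEnum_eq`: any part of the covering
class may be used), injective on the rows of the block (`pasteEnum_inj`), onto the block, and the colour / adjacency bits of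
`paste` are exactly the colours / adjacencies along it (`pCol_iff`, `pAdj_iff`: inside one copy the part's own bits, across
copies the switching datum of two distinct components), i.e. `paste = bitEnc … pasteEnum` (`paste_eq_bitEnc`).  Sorry-free;
supports stmt-PneNP-14781.
-/

set_option linter.dupNamespace false -- `Summit.PneNP.PneNP.…` (D-0017 single-conjunct layout)

namespace Summit.PneNP.PneNP.Theorems

open Finset BranchSum

namespace CGBits

variable {V : Type*} [DecidableEq V] {G : SimpleGraph V} [DecidableRel G.Adj] {n : ℕ}

section Paste

variable {I : CGInst V} (hs : cgStep G I = .andNode (cgParts G I)) {f : CGInst V → BVal n} {eJ : CGInst V → Fin n → V}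
  (hP : PartEnums G n I f eJ) (hI : Wf n I)
include hs hP hI

/-! ### Pasting: the enumeration of the block -/

/-- Reading a total function `Fin n → V` at a natural index (junk past `n`). -/
noncomputable def atNat (I : CGInst V) (g : Fin n → V) (k : ℕ) : V := if h : k < n then g ⟨k, h⟩ else I.2.choose

variable (G n) in
/-- The `q`-th part of the class of `J` (through `Finset.equivFin` of the class; junk past the multiplicity). -/
noncomputable def classPart (I : CGInst V) (f : CGInst V → BVal n) (J : CGInst V) (q : ℕ) : CGInst V :=
  if h : q < mult G n I f J then (((cgParts G I).filter fun J' => f J' = f J).equivFin.symm ⟨q, h⟩ : CGInst V) else J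

variable (G n) in
open scoped Classical in
/-- **The enumeration of the block read off the pasted layout**: row `i`, covered by the class of `J` in copy `q` at
offset `o`, is the `o`-th vertex of the `q`-th part of that class. -/
noncomputable def pasteEnum (I : CGInst V) (f : CGInst V → BVal n) (eJ : CGInst V → Fin n → V) : Fin n → V := fun i =>
  if h : ∃ J, Covers G n I f J i then
    atNat I (eJ (classPart G n I f h.choose ((i - ltCnt G n I f h.choose) / h.choose.1.1.card)))
      ((i - ltCnt G n I f h.choose) % h.choose.1.1.card)
  else I.2.choose

omit hP hI hs in
/-- Transport of `Finset.equivFin` along an equality of finsets. [folklore] -/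
theorem equivFin_symm_congr {α : Type*} {s t : Finset α} (h : s = t) (q : ℕ) (hq : q < s.card) (hq' : q < t.card) :
    ((s.equivFin.symm ⟨q, hq⟩ : s) : α) = (t.equivFin.symm ⟨q, hq'⟩ : α) := by subst h; rfl

omit hP hI hs in
/-- Below the multiplicity, `classPart` depends on the value only. [folklore] -/
theorem classPart_congr {J J' : CGInst V} (h : f J = f J') {q : ℕ} (hq : q < mult G n I f J) :
    classPart G n I f J q = classPart G n I f J' q := by
  unfold classPart
  have hm := mult_congr (G := G) (n := n) (I := I) h
  rw [dif_pos hq, dif_pos (hm ▸ hq)]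
  exact equivFin_symm_congr (by rw [h]) q _ _

omit hP hI hs in
/-- Below the multiplicity, `classPart J q` is a part of the class of `J`. [folklore] -/
theorem classPart_mem {J : CGInst V} {q : ℕ} (hq : q < mult G n I f J) :
    classPart G n I f J q ∈ cgParts G I ∧ f (classPart G n I f J q) = f J := by
  unfold classPart
  rw [dif_pos hq]
  exact mem_filter.1 (coe_mem _)

omit hP hI hs in
/-- Below the multiplicity, `classPart J` is injective. [folklore] -/
theorem classPart_inj {J : CGInst V} {q q' : ℕ} (hq : q < mult G n I f J) (hq' : q' < mult G n I f J)
    (h : classPart G n I f J q = classPart G n I f J q') : q = q' := by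
  unfold classPart at h
  rw [dif_pos hq, dif_pos hq'] at h
  have := ((cgParts G I).filter fun J' => f J' = f J).equivFin.symm.injective (Subtype.ext h)
  simpa using congrArg Fin.val this

/-! ### Pasting: properties of the enumeration -/

omit hs in
/-- Covering transfers across a class. [folklore] -/
theorem covers_of_f_eq {J J' : CGInst V} {i : ℕ} (hc : Covers G n I f J i) (hJ' : J' ∈ cgParts G I) (h : f J = f J') :
    Covers G n I f J' i := by
  obtain ⟨hJ, hle, hlt⟩ := (covers_iff i).1 hc
  refine (covers_iff i).2 ⟨hJ', ?_, ?_⟩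
  · rwa [← ltCnt_congr h]
  · rwa [← ltCnt_congr h, ← mult_congr h, ← card_eq_of_f_eq hP hI hJ hJ' h]

omit [DecidableEq V] hP hI hs in
/-- Reading `atNat` below `n`. [folklore] -/
theorem atNat_of_lt (g : Fin n → V) {k : ℕ} (hk : k < n) : atNat I g k = g ⟨k, hk⟩ := by
  unfold atNat; rw [dif_pos hk]

omit hs hI in
/-- The offset of a covered row is below `n`. [folklore] -/
theorem offset_lt {J : CGInst V} (hJ : J ∈ cgParts G I) (i : ℕ) : (i - ltCnt G n I f J) % J.1.1.card < n :=
  (Nat.mod_lt _ (card_pos.2 J.2)).trans_le (hP.isEnum J hJ).card_le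

omit hs in
/-- **The value of the enumeration at a covered row**, through ANY part of the covering class (copy index and offset given up
to propositional equality, to keep rewriting free of dependent arguments). [folklore] -/
theorem pasteEnum_eq {J : CGInst V} {i : Fin n} (hc : Covers G n I f J i) {q : ℕ}
    (hq : (i - ltCnt G n I f J) / J.1.1.card = q) {o : Fin n} (ho : (i - ltCnt G n I f J) % J.1.1.card = o) :
    pasteEnum G n I f eJ i = eJ (classPart G n I f J q) o := by
  obtain rfl : o = ⟨_, offset_lt hP hc.1 i⟩ := Fin.ext ho.symm
  subst hq
  have hex : ∃ J, Covers G n I f J i := ⟨J, hc⟩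
  unfold pasteEnum
  rw [dif_pos hex]
  have hf : f hex.choose = f J := f_eq_of_covers hP hI hex.choose_spec hc
  have hl : ltCnt G n I f hex.choose = ltCnt G n I f J := ltCnt_congr hf
  have hcard : hex.choose.1.1.card = J.1.1.card := card_eq_of_f_eq hP hI hex.choose_spec.1 hc.1 hf
  have hq : (i - ltCnt G n I f hex.choose) / hex.choose.1.1.card < mult G n I f hex.choose := hex.choose_spec.2.2
  rw [classPart_congr hf hq, hl, hcard, atNat_of_lt]

omit hs hP hI in
/-- The part of the class of `J` at a covered row is a part with the value of `J`. [folklore] -/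
theorem classPart_covers {J : CGInst V} {i : ℕ} (hc : Covers G n I f J i) :
    classPart G n I f J ((i - ltCnt G n I f J) / J.1.1.card) ∈ cgParts G I ∧
      f (classPart G n I f J ((i - ltCnt G n I f J) / J.1.1.card)) = f J :=
  classPart_mem hc.2.2

omit hs in
/-- The enumeration at a covered row lies in the corresponding part. [folklore] -/
theorem pasteEnum_mem {J : CGInst V} {i : Fin n} (hc : Covers G n I f J i) :
    pasteEnum G n I f eJ i ∈ (classPart G n I f J ((i - ltCnt G n I f J) / J.1.1.card)).1.1 := by
  rw [pasteEnum_eq hP hI hc rfl (o := ⟨_, offset_lt hP hc.1 i⟩) rfl]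
  obtain ⟨hPp, hfP⟩ := classPart_covers hc
  refine (hP.isEnum _ hPp).mem _ ?_
  rw [card_eq_of_f_eq hP hI hPp hc.1 hfP]
  exact Nat.mod_lt _ (card_pos.2 J.2)

/-- Covered rows are rows of the block. [folklore] -/
theorem lt_card_of_covers {J : CGInst V} {i : ℕ} (hc : Covers G n I f J i) : i < I.1.1.card := by
  obtain ⟨hJ, -, hlt⟩ := (covers_iff i).1 hc
  exact hlt.trans_le (ltCnt_add_le hs hP hI hJ)

/-- Rows of the block lie in the block. [folklore] -/
theorem pasteEnum_mem_block {i : Fin n} (hi : (i : ℕ) < I.1.1.card) : pasteEnum G n I f eJ i ∈ I.1.1 := by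
  obtain ⟨J, hc⟩ := exists_covers hs hP hI hi
  exact part_subset (classPart_covers hc).1 (pasteEnum_mem hP hI hc)

omit hP hI in
/-- Two parts sharing a vertex are equal. [folklore] -/
theorem part_eq_of_mem {P P' : CGInst V} (hP' : P ∈ cgParts G I) (hP'' : P' ∈ cgParts G I) {u : V} (hu : u ∈ P.1.1)
    (hu' : u ∈ P'.1.1) : P = P' := by
  by_contra hne
  exact disjoint_left.1 (parts_disjoint hs hP' hP'' hne) hu hu'

omit hs hI in
/-- The colour bits of a part's value. [folklore] -/
theorem part_cIdx {P : CGInst V} (hPp : P ∈ cgParts G I) (o c : Fin n) :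
    f P (cIdx o c) = decide ((o : ℕ) < P.1.1.card ∧ I.1.2 (eJ P o) = c) := by
  rw [hP.eq P hPp, bitEnc_cIdx]

omit hs hI in
/-- The adjacency bits of a part's value. [folklore] -/
theorem part_aIdx {P : CGInst V} (hPp : P ∈ cgParts G I) (o o' : Fin n) :
    f P (aIdx o o') = decide ((o : ℕ) < P.1.1.card ∧ (o' : ℕ) < P.1.1.card ∧ G.Adj (eJ P o) (eJ P o')) := by
  rw [hP.eq P hPp, bitEnc_aIdx]

omit hs in
/-- **Two covered rows landing in the same part**: their covering classes agree, and so do their copies. [folklore] -/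
theorem same_of_part_eq {J J' : CGInst V} {i j : Fin n} (hci : Covers G n I f J i) (hcj : Covers G n I f J' j)
    (h : classPart G n I f J ((i - ltCnt G n I f J) / J.1.1.card) = classPart G n I f J' ((j - ltCnt G n I f J') / J'.1.1.card)) :
    f J = f J' ∧ (i - ltCnt G n I f J) / J.1.1.card = (j - ltCnt G n I f J) / J.1.1.card := by
  obtain ⟨-, hfi⟩ := classPart_covers hci
  obtain ⟨-, hfj⟩ := classPart_covers hcj
  have hf : f J = f J' := hfi.symm.trans ((congrArg f h).trans hfj)
  refine ⟨hf, ?_⟩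
  have hcj' : Covers G n I f J j := covers_of_f_eq hP hI hcj hci.1 hf.symm
  have hlt : ltCnt G n I f J' = ltCnt G n I f J := ltCnt_congr hf.symm
  have hcard : J'.1.1.card = J.1.1.card := card_eq_of_f_eq hP hI hcj.1 hci.1 hf.symm
  rw [classPart_congr hf.symm hcj.2.2, hlt, hcard] at h
  exact classPart_inj hci.2.2 hcj'.2.2 h

/-- **The enumeration is injective on the rows of the block.** [folklore] -/
theorem pasteEnum_inj {i j : Fin n} (hi : (i : ℕ) < I.1.1.card) (hj : (j : ℕ) < I.1.1.card)
    (h : pasteEnum G n I f eJ i = pasteEnum G n I f eJ j) : i = j := by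
  obtain ⟨J, hci⟩ := exists_covers hs hP hI hi
  obtain ⟨J', hcj⟩ := exists_covers hs hP hI hj
  have hPi := pasteEnum_mem hP hI hci
  have hPj := pasteEnum_mem hP hI hcj
  rw [h] at hPi
  have hPP := part_eq_of_mem hs (classPart_covers hci).1 (classPart_covers hcj).1 hPi hPj
  obtain ⟨hf, hq⟩ := same_of_part_eq hP hI hci hcj hPP
  have hcj' : Covers G n I f J j := covers_of_f_eq hP hI hcj hci.1 hf.symm
  -- same part, same copy: the offsets agree by injectivity of the part's enumeration
  rw [pasteEnum_eq hP hI hci rfl (o := ⟨_, offset_lt hP hci.1 i⟩) rfl,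
    pasteEnum_eq hP hI hcj' hq.symm (o := ⟨_, offset_lt hP hci.1 j⟩) rfl] at h
  have hPp := (classPart_covers hci).1
  have hcardP : (classPart G n I f J ((i - ltCnt G n I f J) / J.1.1.card)).1.1.card = J.1.1.card :=
    card_eq_of_f_eq hP hI hPp hci.1 (classPart_covers hci).2
  have ho := (hP.isEnum _ hPp).inj _ _ (by rw [hcardP]; exact Nat.mod_lt _ (card_pos.2 J.2))
    (by rw [hcardP]; exact Nat.mod_lt _ (card_pos.2 J.2)) h
  have ho' : (i - ltCnt G n I f J) % J.1.1.card = (j - ltCnt G n I f J) % J.1.1.card := by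
    rw [Fin.mk.injEq] at ho
    exact ho
  have hi' := Nat.div_add_mod (i - ltCnt G n I f J) J.1.1.card
  have hj' := Nat.div_add_mod (j - ltCnt G n I f J) J.1.1.card
  rw [← hq, ← ho'] at hj'
  have hle_i := hci.2.1
  have hle_j := hcj'.2.1
  apply Fin.ext
  omega

/-- **The enumeration enumerates the block.** [folklore] -/
theorem isEnum_pasteEnum [Fintype V] (hn : Fintype.card V ≤ n) : IsEnum n I.1.1 (pasteEnum G n I f eJ) where
  card_le := (card_le_univ _).trans hn
  mem _ hi := pasteEnum_mem_block hs hP hI hi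
  inj _ _ hi hj h := pasteEnum_inj hs hP hI hi hj h

/-- **The colour bits of the pasted value are the colours along the enumeration.** [folklore] -/
theorem pCol_iff (i c : Fin n) : PCol G n I f i c ↔ (i : ℕ) < I.1.1.card ∧ I.1.2 (pasteEnum G n I f eJ i) = c := by
  constructor
  · rintro ⟨J, hc, o, ho, hbit⟩
    refine ⟨lt_card_of_covers hs hP hI hc, ?_⟩
    obtain ⟨hPp, hfP⟩ := classPart_covers hc
    rw [← hfP, part_cIdx hP hPp, decide_eq_true_eq] at hbit
    rw [pasteEnum_eq hP hI hc rfl ho.symm]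
    exact hbit.2
  · rintro ⟨hi, hcol⟩
    obtain ⟨J, hc⟩ := exists_covers hs hP hI hi
    obtain ⟨hPp, hfP⟩ := classPart_covers hc
    refine ⟨J, hc, ⟨_, offset_lt hP hc.1 i⟩, rfl, ?_⟩
    rw [← hfP, part_cIdx hP hPp, decide_eq_true_eq]
    refine ⟨?_, ?_⟩
    · rw [card_eq_of_f_eq hP hI hPp hc.1 hfP]
      exact Nat.mod_lt _ (card_pos.2 J.2)
    · rw [pasteEnum_eq hP hI hc rfl (o := ⟨_, offset_lt hP hc.1 i⟩) rfl] at hcol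
      exact hcol

omit hs in
/-- `SameCopy` holds exactly when the two rows are covered and land in the same part. [folklore] -/
theorem sameCopy_iff {i j : Fin n} : SameCopy G n I f i j ↔ ∃ J, Covers G n I f J i ∧ Covers G n I f J j ∧
    classPart G n I f J ((i - ltCnt G n I f J) / J.1.1.card) = classPart G n I f J ((j - ltCnt G n I f J) / J.1.1.card) := by
  constructor
  · rintro ⟨J, hci, hcj, hq⟩
    exact ⟨J, hci, hcj, by rw [hq]⟩
  · rintro ⟨J, hci, hcj, h⟩
    exact ⟨J, hci, hcj, (same_of_part_eq hP hI hci hcj h).2⟩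

/-- **The adjacency bits of the pasted value are the adjacencies along the enumeration.** [folklore] -/
theorem pAdj_iff (i j : Fin n) : PAdj G n I f i j ↔
    (i : ℕ) < I.1.1.card ∧ (j : ℕ) < I.1.1.card ∧ G.Adj (pasteEnum G n I f eJ i) (pasteEnum G n I f eJ j) := by
  constructor
  · rintro (⟨J, hci, hcj, hq, o, o', ho, ho', hbit⟩ | ⟨hns, c, c', hc, hc', hsw⟩)
    · -- inside one copy: the part's own bit
      refine ⟨lt_card_of_covers hs hP hI hci, lt_card_of_covers hs hP hI hcj, ?_⟩
      obtain ⟨hPp, hfP⟩ := classPart_covers hci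
      rw [← hfP, part_aIdx hP hPp, decide_eq_true_eq] at hbit
      rw [pasteEnum_eq hP hI hci rfl ho.symm, pasteEnum_eq hP hI hcj hq.symm ho'.symm]
      exact hbit.2.2
    · -- across copies: distinct parts, uniform cross data
      obtain ⟨hi, hci⟩ := (pCol_iff hs hP hI i c).1 hc
      obtain ⟨hj, hcj⟩ := (pCol_iff hs hP hI j c').1 hc'
      refine ⟨hi, hj, ?_⟩
      obtain ⟨J, hcJ⟩ := exists_covers hs hP hI hi
      obtain ⟨J', hcJ'⟩ := exists_covers hs hP hI hj
      have hne : classPart G n I f J ((i - ltCnt G n I f J) / J.1.1.card) ≠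
          classPart G n I f J' ((j - ltCnt G n I f J') / J'.1.1.card) := by
        intro h
        obtain ⟨hf, -⟩ := same_of_part_eq hP hI hcJ hcJ' h
        have hcJj : Covers G n I f J j := covers_of_f_eq hP hI hcJ' hcJ.1 hf.symm
        refine hns ((sameCopy_iff hP hI).2 ⟨J, hcJ, hcJj, ?_⟩)
        rw [h, ← classPart_congr hf (by rw [mult_congr hf]; exact hcJ'.2.2), ltCnt_congr hf.symm,
          card_eq_of_f_eq hP hI hcJ'.1 hcJ.1 hf.symm]
      rw [adj_iff_swComp_of_ne (classPart_covers hcJ).1 (classPart_covers hcJ').1 hne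
        (pasteEnum_mem hP hI hcJ) (pasteEnum_mem hP hI hcJ'), ← swCompC_iff, hci, hcj]
      exact hsw
  · rintro ⟨hi, hj, hadj⟩
    obtain ⟨J, hcJ⟩ := exists_covers hs hP hI hi
    obtain ⟨J', hcJ'⟩ := exists_covers hs hP hI hj
    by_cases hPP : classPart G n I f J ((i - ltCnt G n I f J) / J.1.1.card) =
        classPart G n I f J' ((j - ltCnt G n I f J') / J'.1.1.card)
    · -- same part: same class and same copy, the part's own bit
      left
      obtain ⟨hf, hq⟩ := same_of_part_eq hP hI hcJ hcJ' hPP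
      have hcJj : Covers G n I f J j := covers_of_f_eq hP hI hcJ' hcJ.1 hf.symm
      refine ⟨J, hcJ, hcJj, hq, ⟨_, offset_lt hP hcJ.1 i⟩, ⟨_, offset_lt hP hcJ.1 j⟩, rfl, rfl, ?_⟩
      obtain ⟨hPp, hfP⟩ := classPart_covers hcJ
      rw [← hfP, part_aIdx hP hPp, decide_eq_true_eq]
      have hcardP := card_eq_of_f_eq hP hI hPp hcJ.1 hfP
      refine ⟨by rw [hcardP]; exact Nat.mod_lt _ (card_pos.2 J.2), by rw [hcardP]; exact Nat.mod_lt _ (card_pos.2 J.2), ?_⟩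
      rw [pasteEnum_eq hP hI hcJ rfl (o := ⟨_, offset_lt hP hcJ.1 i⟩) rfl,
        pasteEnum_eq hP hI hcJj hq.symm (o := ⟨_, offset_lt hP hcJ.1 j⟩) rfl] at hadj
      exact hadj
    · -- distinct parts: the switching datum of the two colours
      right
      refine ⟨fun hsc => hPP ?_, ⟨I.1.2 (pasteEnum G n I f eJ i), hI _ (pasteEnum_mem_block hs hP hI hi)⟩,
        ⟨I.1.2 (pasteEnum G n I f eJ j), hI _ (pasteEnum_mem_block hs hP hI hj)⟩,
        (pCol_iff hs hP hI i _).2 ⟨hi, rfl⟩, (pCol_iff hs hP hI j _).2 ⟨hj, rfl⟩, ?_⟩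
      · obtain ⟨K, hcK, hcK', hK⟩ := (sameCopy_iff hP hI).1 hsc
        -- `i` and `j` land in the same part `classPart K _`; so do their canonical parts
        have h1 := part_eq_of_mem hs (classPart_covers hcJ).1 (classPart_covers hcK).1
          (pasteEnum_mem hP hI hcJ) (pasteEnum_mem hP hI hcK)
        have h2 := part_eq_of_mem hs (classPart_covers hcJ').1 (classPart_covers hcK').1
          (pasteEnum_mem hP hI hcJ') (pasteEnum_mem hP hI hcK')
        rw [h1, h2, hK]
      · show SwCompC G I.1.1 I.1.2 (I.1.2 (pasteEnum G n I f eJ i)) (I.1.2 (pasteEnum G n I f eJ j))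
        rw [swCompC_iff]
        exact (adj_iff_swComp_of_ne (classPart_covers hcJ).1 (classPart_covers hcJ').1 hPP
          (pasteEnum_mem hP hI hcJ) (pasteEnum_mem hP hI hcJ')).1 hadj

/-- **The pasted value is the encoding along the enumeration.** [folklore] -/
theorem paste_eq_bitEnc : paste G n I f = bitEnc G n I.1.2 I.1.1.card (pasteEnum G n I f eJ) := by
  unfold paste
  rw [if_pos hI]
  refine bval_ext (fun i c => ?_) (fun i j => ?_)
  · simp only [bdec_cIdx, bitEnc_cIdx]
    exact decide_eq_decide.2 (pCol_iff hs hP hI i c)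
  · simp only [bdec_aIdx, bitEnc_aIdx]
    exact decide_eq_decide.2 (pAdj_iff hs hP hI i j)

end Paste

end CGBits

end Summit.PneNP.PneNP.Theorems
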